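/-
COR-CM (cell pub-hodgecm2, stage 2 of the Hodge ladder) — count-neutral KERNEL CENSUS TRANSPORT, degree 16, type ℤ/16 (seat
prover-pub-hodgecm2-b23-g35-0, binder prover b23, gen 35→; claim DEG16-CYCLIC; sequel of `CorCM/FaceCensusHintedChecksPre.lean`,
`Census/HexadecicFaceGeneratorsCyclic{A,B,C}.lean` and `Census/HexadecicFaceTransportCyclicChecks{A,B,C}.lean`). Theorems only:
the generation binder (via `FaceCensus.hgen_of_preChecks` from the kernel-checked linear-time side checks, used BY NAME), the non-
vacuity of the face readings and the CLOSED field-closure theorem (GalT form; the Aut and generator forms are the sequels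
`…TransportCyclicAut.lean`, `…TransportCyclicIntrinsic.lean`). No definition, no named fact, nothing asserted; `Interfaces.lean`
(C1), every E term, B01 and `Transposition/*` are untouched. HONEST FRAMING (COORDINATOR RULING — HODGE FRAMING CORRECTION,
2026-08-21T11:55:35Z): `HC_CM` is NOT proved, here or anywhere in the tree. Every closing theorem below is CONDITIONAL on face-
period witnesses (for ONE field, on the fifteen listed faces); no period is proved here.
T5 (coordinator ruling 15:33:56Z (3)): the census binders of the transport are DISCHARGED in the kernel
(`Census/HexadecicFaceTransportCyclicChecks{A,B,C}.lean`: `certsPre`, `cellsFlatOK`, `pairsOK`, `coverA`, `coverHints`, `hintsComplete`);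
the dictionary binders (`e`, `hmul`, `hconj` / `ε`, `hε`, `c`) say «Gal(K/ℚ) ≅ ℤ/16 with complex conjugation ↦ 8» and are inhabited by every
cyclic CM field of degree 16 (the intrinsic sequel derives them from ONE generator); the face-reading binders are INHABITED IN THE KERNEL for
every such enumeration (`exists_faces_hexadecicCyclic`); the only remaining hypotheses are the fifteen period witnesses on the listed faces =
instances of the crux (`FacePeriodExists` / B01-S), against which the tree has no `¬` theorem on the universe of record — no contradiction
derivable; checker: self (prover-pub-hodgecm2-b23-g35-0), 2026-08-22.
-/
import Summits.HodgeConjecture.CorCM.Census.HexadecicFaceTransportCyclicChecksB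
import Summits.HodgeConjecture.CorCM.Census.HexadecicFaceTransportCyclicChecksC
import HarnessLib

/-!
# Degree 16, cyclic type `ℤ/16` (`ℚ(ζ₁₇)`): fifteen face periods per field close its slice (census transport)

Census transport instance for the cyclic CM closure type of order 16, `(ℤ/16, c = 8)` — `ℚ(ζ₁₇)` and every cyclic CM field `K` of
degree 16 (no proper CM subfield; 256 primitive CM types in 16 translation blocks = sixteen simple CM eightfolds `B₀,…,B₁₅` split
by `K`, every one of them nondegenerate by seat b04ʼs `CyclicTwoPower*`, so the powers `B_bⁿ` are unconditional and ALL
exceptional classes of the slice live on mixed products) — with the generating data of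
`Census/HexadecicFaceGeneratorsCyclic{A,B,C}.lean`: the FIFTEEN orbits of the index-1 set of kit job j144808 (`HOME/pub-
hodgecm2-b23/CYCLIC-MU.md`: μ(ℤ/16) = 15 exactly, all eight odd characters of ℤ/16 have multiplicity 15 in H/P) among the 112
square orbits, represented by the faces `R₁ = (255; 257, 8224)` … `R₁₅ = (4845; 2056, 32896)` (three on the `g`-interval type
`{0,…,7}` = 255, the others on its neighbours 765, 1275, 2295, 2805, 4845). CONTENTS: the generation binder `hgen(𝒮, σ₀)` of
INT2-GEN for every set `𝒮` of faces of `K` containing faces that READ AS the fifteen generating representatives under an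
enumeration `e : GalT K ≃ Fin 16` of the table (from `FaceCensus.hgen_of_preChecks`: pre-expanded certificates, hinted cover, flat
orbit cells); non-vacuity of those readings; and the CLOSED field-closure theorem on the universe of record — period witnesses on
those fifteen faces ⟹ the Hodge conjecture, in every codimension, for every complex abelian variety dominated by a finite product
of abelian varieties realising CM types of CM fields embeddable in `K`. This is the degree-16 rung of the INT-2 ladder `1 ·
(1,2,2,3,2,2) · 3 · (5,6,8,5) · 9 · 15` (degrees `6 · 8 · 10 · 12 · 14 · 16`, cyclic types `1·1·3·5·9·15`). `HC_CM` is NOT proved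
and nothing here produces a period.

References: [cite: Pohlmann1968, Thm. 1]; [cite: Milne1999LefschetzClasses, Thm. 3.2 and Cor. 4.5];
[cite: Shimura1998, §6.2 Theorem 3 and §6.1 Corollary of Theorem 2 (pp. 41–43)]; [cite: MumfordAV1970, §19 Thm. 1 and p. 169].
-/

noncomputable section

open CategoryTheory NumberField NumberField.ComplexEmbedding
open Literature.AlgebraicGeometry Literature.AlgebraicGeometry.Motives Literature.AlgebraicGeometry.HodgeTheory
open Literature.AlgebraicGeometry.ComplexMultiplication Literature.AlgebraicGeometry.Milne1999
open Literature.NumberTheory.Automorphic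
open Literature.NumberTheory.Automorphic.PicardCM
open Summit.HodgeConjecture.CorCM.Domination

namespace Summit.HodgeConjecture.CorCM.HexadecicFaceTransport.Cyclic

open Summit.HodgeConjecture.CorCM.Census.FaceSquaresModel (mem flipAt)
open Summit.HodgeConjecture.CorCM.Census.HexadecicFaceGeneratorsCyclic (Γ genReps certs certsX trans hints)


/-- **The generation binder, type `ℤ/16` (cyclic, degree 16; `c = 8`).** `K` a Galois CM field with an enumeration `e : GalT K ≃ Fin
16` of its Galois translates, multiplicative for b30's table and with `e conjT = 8`; `σ₀` a base embedding; `𝒮` any set of faces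
of `K` containing faces READING AS the 15 generating representative codes `(255, 257, 8224)` (type `{0,1,2,3,4,5,6,7}`, places
`{0,8}`, `{5,13}`), `(255, 514, 16448)` (type `{0,1,2,3,4,5,6,7}`, places `{1,9}`, `{6,14}`), `(255, 4112, 8224)` (type
`{0,1,2,3,4,5,6,7}`, places `{4,12}`, `{5,13}`), `(765, 1028, 4112)` (type `{0,2,3,4,5,6,7,9}`, places `{2,10}`, `{4,12}`), `(765,
1028, 32896)` (type `{0,2,3,4,5,6,7,9}`, places `{2,10}`, `{7,15}`), `(765, 4112, 16448)` (type `{0,2,3,4,5,6,7,9}`, places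
`{4,12}`, `{6,14}`), `(1275, 514, 2056)` (type `{0,1,3,4,5,6,7,10}`, places `{1,9}`, `{3,11}`), `(1275, 514, 4112)` (type
`{0,1,3,4,5,6,7,10}`, places `{1,9}`, `{4,12}`), `(1275, 2056, 4112)` (type `{0,1,3,4,5,6,7,10}`, places `{3,11}`, `{4,12}`),
`(1275, 4112, 8224)` (type `{0,1,3,4,5,6,7,10}`, places `{4,12}`, `{5,13}`), `(1275, 8224, 16448)` (type `{0,1,3,4,5,6,7,10}`,
places `{5,13}`, `{6,14}`), `(2295, 4112, 32896)` (type `{0,1,2,4,5,6,7,11}`, places `{4,12}`, `{7,15}`), `(2805, 16448, 32896)`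
(type `{0,2,4,5,6,7,9,11}`, places `{6,14}`, `{7,15}`), `(4845, 2056, 8224)` (type `{0,2,3,5,6,7,9,12}`, places `{3,11}`,
`{5,13}`), `(4845, 2056, 32896)` (type `{0,2,3,5,6,7,9,12}`, places `{3,11}`, `{7,15}`) — `σ₀ ∘ P ∈ R.Φ ↔ e P ∈` the type, `R.p`,
`R.p′` at the two places. Then `hgen(𝒮, σ₀)` holds at every face (orbit-equivariant certificates of
`Census/HexadecicFaceGeneratorsCyclicC.lean`, checked in `Census/HexadecicFaceTransportCyclicCerts.lean` / `…Checks.lean`: the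
nine atom orbits of lit-andre-3ʼs `HexadecicCyclicSpecies.orbitRep` among the 112 generate). [cite: Pohlmann1968, Thm. 1] [cite:
Milne1999LefschetzClasses, Thm. 3.2] -/
theorem hgen_hexadecicCyclic (K : CMField) [IsGalois ℚ K] (e : GalT K ≃ Fin 16)
    (hmul : ∀ P Q : GalT K, e (P * Q) = Γ.mul (e P) (e Q)) (hconj : e conjT = Γ.conj) (σ₀ : (K : Type) →+* ℂ)
    (𝒮 : Set (Face K))
    (h₁ : ∃ R ∈ 𝒮, (∀ P : GalT K, P.1 σ₀ ∈ R.Φ.1 ↔ mem (e P) 255 = true) ∧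
      Γ.placeMask (e (translate σ₀ R.p)) = 257 ∧ Γ.placeMask (e (translate σ₀ R.p')) = 8224)
    (h₂ : ∃ R ∈ 𝒮, (∀ P : GalT K, P.1 σ₀ ∈ R.Φ.1 ↔ mem (e P) 255 = true) ∧
      Γ.placeMask (e (translate σ₀ R.p)) = 514 ∧ Γ.placeMask (e (translate σ₀ R.p')) = 16448)
    (h₃ : ∃ R ∈ 𝒮, (∀ P : GalT K, P.1 σ₀ ∈ R.Φ.1 ↔ mem (e P) 255 = true) ∧
      Γ.placeMask (e (translate σ₀ R.p)) = 4112 ∧ Γ.placeMask (e (translate σ₀ R.p')) = 8224)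
    (h₄ : ∃ R ∈ 𝒮, (∀ P : GalT K, P.1 σ₀ ∈ R.Φ.1 ↔ mem (e P) 765 = true) ∧
      Γ.placeMask (e (translate σ₀ R.p)) = 1028 ∧ Γ.placeMask (e (translate σ₀ R.p')) = 4112)
    (h₅ : ∃ R ∈ 𝒮, (∀ P : GalT K, P.1 σ₀ ∈ R.Φ.1 ↔ mem (e P) 765 = true) ∧
      Γ.placeMask (e (translate σ₀ R.p)) = 1028 ∧ Γ.placeMask (e (translate σ₀ R.p')) = 32896)
    (h₆ : ∃ R ∈ 𝒮, (∀ P : GalT K, P.1 σ₀ ∈ R.Φ.1 ↔ mem (e P) 765 = true) ∧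
      Γ.placeMask (e (translate σ₀ R.p)) = 4112 ∧ Γ.placeMask (e (translate σ₀ R.p')) = 16448)
    (h₇ : ∃ R ∈ 𝒮, (∀ P : GalT K, P.1 σ₀ ∈ R.Φ.1 ↔ mem (e P) 1275 = true) ∧
      Γ.placeMask (e (translate σ₀ R.p)) = 514 ∧ Γ.placeMask (e (translate σ₀ R.p')) = 2056)
    (h₈ : ∃ R ∈ 𝒮, (∀ P : GalT K, P.1 σ₀ ∈ R.Φ.1 ↔ mem (e P) 1275 = true) ∧
      Γ.placeMask (e (translate σ₀ R.p)) = 514 ∧ Γ.placeMask (e (translate σ₀ R.p')) = 4112)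
    (h₉ : ∃ R ∈ 𝒮, (∀ P : GalT K, P.1 σ₀ ∈ R.Φ.1 ↔ mem (e P) 1275 = true) ∧
      Γ.placeMask (e (translate σ₀ R.p)) = 2056 ∧ Γ.placeMask (e (translate σ₀ R.p')) = 4112)
    (h₁₀ : ∃ R ∈ 𝒮, (∀ P : GalT K, P.1 σ₀ ∈ R.Φ.1 ↔ mem (e P) 1275 = true) ∧
      Γ.placeMask (e (translate σ₀ R.p)) = 4112 ∧ Γ.placeMask (e (translate σ₀ R.p')) = 8224)
    (h₁₁ : ∃ R ∈ 𝒮, (∀ P : GalT K, P.1 σ₀ ∈ R.Φ.1 ↔ mem (e P) 1275 = true) ∧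
      Γ.placeMask (e (translate σ₀ R.p)) = 8224 ∧ Γ.placeMask (e (translate σ₀ R.p')) = 16448)
    (h₁₂ : ∃ R ∈ 𝒮, (∀ P : GalT K, P.1 σ₀ ∈ R.Φ.1 ↔ mem (e P) 2295 = true) ∧
      Γ.placeMask (e (translate σ₀ R.p)) = 4112 ∧ Γ.placeMask (e (translate σ₀ R.p')) = 32896)
    (h₁₃ : ∃ R ∈ 𝒮, (∀ P : GalT K, P.1 σ₀ ∈ R.Φ.1 ↔ mem (e P) 2805 = true) ∧
      Γ.placeMask (e (translate σ₀ R.p)) = 16448 ∧ Γ.placeMask (e (translate σ₀ R.p')) = 32896)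
    (h₁₄ : ∃ R ∈ 𝒮, (∀ P : GalT K, P.1 σ₀ ∈ R.Φ.1 ↔ mem (e P) 4845 = true) ∧
      Γ.placeMask (e (translate σ₀ R.p)) = 2056 ∧ Γ.placeMask (e (translate σ₀ R.p')) = 8224)
    (h₁₅ : ∃ R ∈ 𝒮, (∀ P : GalT K, P.1 σ₀ ∈ R.Φ.1 ↔ mem (e P) 4845 = true) ∧
      Γ.placeMask (e (translate σ₀ R.p)) = 2056 ∧ Γ.placeMask (e (translate σ₀ R.p')) = 32896) (f : Face K) :
    lefChar f.corner (fun _ => ({σ₀} : Finset ((K : Type) →+* ℂ))) ∈ AddSubgroup.closure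
      {a : Asym K | ∃ g ∈ 𝒮, ∃ σ : (K : Type) →+* ℂ, a = lefChar g.corner (fun _ => ({σ} : Finset ((K : Type) →+* ℂ)))} := by
  refine FaceCensus.hgen_of_preChecks Γ e hmul hconj genReps certsX certsPre.2 trans coverA hints coverHints hintsComplete
    cellsFlatOK pairsOK.2 σ₀ 𝒮 ?_ f
  intro r hr
  have hr' : r = (255, 257, 8224) ∨ r = (255, 514, 16448) ∨ r = (255, 4112, 8224) ∨ r = (765, 1028, 4112) ∨ r = (765, 1028, 32896) ∨ r = (765, 4112, 16448) ∨ r = (1275, 514, 2056) ∨ r = (1275, 514, 4112) ∨ r = (1275, 2056, 4112) ∨ r = (1275, 4112, 8224) ∨ r = (1275, 8224, 16448) ∨ r = (2295, 4112, 32896) ∨ r = (2805, 16448, 32896) ∨ r = (4845, 2056, 8224) ∨ r = (4845, 2056, 32896) := by simpa [genReps] using hr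
  rcases hr' with rfl | rfl | rfl | rfl | rfl | rfl | rfl | rfl | rfl | rfl | rfl | rfl | rfl | rfl | rfl
  · obtain ⟨R, hRS, hΦ, hp, hq⟩ := h₁
    exact ⟨R, hRS, ⟨by decide, fun i => by rw [mem_pullType, hΦ, e.apply_symm_apply]⟩, hp, hq⟩
  · obtain ⟨R, hRS, hΦ, hp, hq⟩ := h₂
    exact ⟨R, hRS, ⟨by decide, fun i => by rw [mem_pullType, hΦ, e.apply_symm_apply]⟩, hp, hq⟩
  · obtain ⟨R, hRS, hΦ, hp, hq⟩ := h₃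
    exact ⟨R, hRS, ⟨by decide, fun i => by rw [mem_pullType, hΦ, e.apply_symm_apply]⟩, hp, hq⟩
  · obtain ⟨R, hRS, hΦ, hp, hq⟩ := h₄
    exact ⟨R, hRS, ⟨by decide, fun i => by rw [mem_pullType, hΦ, e.apply_symm_apply]⟩, hp, hq⟩
  · obtain ⟨R, hRS, hΦ, hp, hq⟩ := h₅
    exact ⟨R, hRS, ⟨by decide, fun i => by rw [mem_pullType, hΦ, e.apply_symm_apply]⟩, hp, hq⟩
  · obtain ⟨R, hRS, hΦ, hp, hq⟩ := h₆
    exact ⟨R, hRS, ⟨by decide, fun i => by rw [mem_pullType, hΦ, e.apply_symm_apply]⟩, hp, hq⟩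
  · obtain ⟨R, hRS, hΦ, hp, hq⟩ := h₇
    exact ⟨R, hRS, ⟨by decide, fun i => by rw [mem_pullType, hΦ, e.apply_symm_apply]⟩, hp, hq⟩
  · obtain ⟨R, hRS, hΦ, hp, hq⟩ := h₈
    exact ⟨R, hRS, ⟨by decide, fun i => by rw [mem_pullType, hΦ, e.apply_symm_apply]⟩, hp, hq⟩
  · obtain ⟨R, hRS, hΦ, hp, hq⟩ := h₉
    exact ⟨R, hRS, ⟨by decide, fun i => by rw [mem_pullType, hΦ, e.apply_symm_apply]⟩, hp, hq⟩
  · obtain ⟨R, hRS, hΦ, hp, hq⟩ := h₁₀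
    exact ⟨R, hRS, ⟨by decide, fun i => by rw [mem_pullType, hΦ, e.apply_symm_apply]⟩, hp, hq⟩
  · obtain ⟨R, hRS, hΦ, hp, hq⟩ := h₁₁
    exact ⟨R, hRS, ⟨by decide, fun i => by rw [mem_pullType, hΦ, e.apply_symm_apply]⟩, hp, hq⟩
  · obtain ⟨R, hRS, hΦ, hp, hq⟩ := h₁₂
    exact ⟨R, hRS, ⟨by decide, fun i => by rw [mem_pullType, hΦ, e.apply_symm_apply]⟩, hp, hq⟩
  · obtain ⟨R, hRS, hΦ, hp, hq⟩ := h₁₃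
    exact ⟨R, hRS, ⟨by decide, fun i => by rw [mem_pullType, hΦ, e.apply_symm_apply]⟩, hp, hq⟩
  · obtain ⟨R, hRS, hΦ, hp, hq⟩ := h₁₄
    exact ⟨R, hRS, ⟨by decide, fun i => by rw [mem_pullType, hΦ, e.apply_symm_apply]⟩, hp, hq⟩
  · obtain ⟨R, hRS, hΦ, hp, hq⟩ := h₁₅
    exact ⟨R, hRS, ⟨by decide, fun i => by rw [mem_pullType, hΦ, e.apply_symm_apply]⟩, hp, hq⟩

set_option maxRecDepth 100000 in -- `List.range (2 ^ 14)` in the kernel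
/-- **Non-vacuity, type `ℤ/16` (cyclic, degree 16; `c = 8`):** under any such enumeration, faces of `K` reading as the generating
representative codes EXIST (`FaceCensus.exists_face_reads`; the codes lie in `Γ.faces` by `decide`). [folklore] -/
theorem exists_faces_hexadecicCyclic (K : CMField) [IsGalois ℚ K] (e : GalT K ≃ Fin 16)
    (hmul : ∀ P Q : GalT K, e (P * Q) = Γ.mul (e P) (e Q)) (hconj : e conjT = Γ.conj) (σ₀ : (K : Type) →+* ℂ) :
    ∃ R₁ R₂ R₃ R₄ R₅ R₆ R₇ R₈ R₉ R₁₀ R₁₁ R₁₂ R₁₃ R₁₄ R₁₅ : Face K,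
      ((∀ P : GalT K, P.1 σ₀ ∈ R₁.Φ.1 ↔ mem (e P) 255 = true) ∧
      Γ.placeMask (e (translate σ₀ R₁.p)) = 257 ∧ Γ.placeMask (e (translate σ₀ R₁.p')) = 8224) ∧
      ((∀ P : GalT K, P.1 σ₀ ∈ R₂.Φ.1 ↔ mem (e P) 255 = true) ∧
      Γ.placeMask (e (translate σ₀ R₂.p)) = 514 ∧ Γ.placeMask (e (translate σ₀ R₂.p')) = 16448) ∧
      ((∀ P : GalT K, P.1 σ₀ ∈ R₃.Φ.1 ↔ mem (e P) 255 = true) ∧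
      Γ.placeMask (e (translate σ₀ R₃.p)) = 4112 ∧ Γ.placeMask (e (translate σ₀ R₃.p')) = 8224) ∧
      ((∀ P : GalT K, P.1 σ₀ ∈ R₄.Φ.1 ↔ mem (e P) 765 = true) ∧
      Γ.placeMask (e (translate σ₀ R₄.p)) = 1028 ∧ Γ.placeMask (e (translate σ₀ R₄.p')) = 4112) ∧
      ((∀ P : GalT K, P.1 σ₀ ∈ R₅.Φ.1 ↔ mem (e P) 765 = true) ∧
      Γ.placeMask (e (translate σ₀ R₅.p)) = 1028 ∧ Γ.placeMask (e (translate σ₀ R₅.p')) = 32896) ∧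
      ((∀ P : GalT K, P.1 σ₀ ∈ R₆.Φ.1 ↔ mem (e P) 765 = true) ∧
      Γ.placeMask (e (translate σ₀ R₆.p)) = 4112 ∧ Γ.placeMask (e (translate σ₀ R₆.p')) = 16448) ∧
      ((∀ P : GalT K, P.1 σ₀ ∈ R₇.Φ.1 ↔ mem (e P) 1275 = true) ∧
      Γ.placeMask (e (translate σ₀ R₇.p)) = 514 ∧ Γ.placeMask (e (translate σ₀ R₇.p')) = 2056) ∧
      ((∀ P : GalT K, P.1 σ₀ ∈ R₈.Φ.1 ↔ mem (e P) 1275 = true) ∧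
      Γ.placeMask (e (translate σ₀ R₈.p)) = 514 ∧ Γ.placeMask (e (translate σ₀ R₈.p')) = 4112) ∧
      ((∀ P : GalT K, P.1 σ₀ ∈ R₉.Φ.1 ↔ mem (e P) 1275 = true) ∧
      Γ.placeMask (e (translate σ₀ R₉.p)) = 2056 ∧ Γ.placeMask (e (translate σ₀ R₉.p')) = 4112) ∧
      ((∀ P : GalT K, P.1 σ₀ ∈ R₁₀.Φ.1 ↔ mem (e P) 1275 = true) ∧
      Γ.placeMask (e (translate σ₀ R₁₀.p)) = 4112 ∧ Γ.placeMask (e (translate σ₀ R₁₀.p')) = 8224) ∧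
      ((∀ P : GalT K, P.1 σ₀ ∈ R₁₁.Φ.1 ↔ mem (e P) 1275 = true) ∧
      Γ.placeMask (e (translate σ₀ R₁₁.p)) = 8224 ∧ Γ.placeMask (e (translate σ₀ R₁₁.p')) = 16448) ∧
      ((∀ P : GalT K, P.1 σ₀ ∈ R₁₂.Φ.1 ↔ mem (e P) 2295 = true) ∧
      Γ.placeMask (e (translate σ₀ R₁₂.p)) = 4112 ∧ Γ.placeMask (e (translate σ₀ R₁₂.p')) = 32896) ∧
      ((∀ P : GalT K, P.1 σ₀ ∈ R₁₃.Φ.1 ↔ mem (e P) 2805 = true) ∧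
      Γ.placeMask (e (translate σ₀ R₁₃.p)) = 16448 ∧ Γ.placeMask (e (translate σ₀ R₁₃.p')) = 32896) ∧
      ((∀ P : GalT K, P.1 σ₀ ∈ R₁₄.Φ.1 ↔ mem (e P) 4845 = true) ∧
      Γ.placeMask (e (translate σ₀ R₁₄.p)) = 2056 ∧ Γ.placeMask (e (translate σ₀ R₁₄.p')) = 8224) ∧
      ((∀ P : GalT K, P.1 σ₀ ∈ R₁₅.Φ.1 ↔ mem (e P) 4845 = true) ∧
      Γ.placeMask (e (translate σ₀ R₁₅.p)) = 2056 ∧ Γ.placeMask (e (translate σ₀ R₁₅.p')) = 32896) := by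
  obtain ⟨R₁, hT₁, hp₁, hq₁⟩ := FaceCensus.exists_face_reads Γ e hmul hconj σ₀ (r := (255, 257, 8224))
    (FaceCensus.mem_faces_of_isFaceB Γ (by decide +kernel))
  obtain ⟨R₂, hT₂, hp₂, hq₂⟩ := FaceCensus.exists_face_reads Γ e hmul hconj σ₀ (r := (255, 514, 16448))
    (FaceCensus.mem_faces_of_isFaceB Γ (by decide +kernel))
  obtain ⟨R₃, hT₃, hp₃, hq₃⟩ := FaceCensus.exists_face_reads Γ e hmul hconj σ₀ (r := (255, 4112, 8224))
    (FaceCensus.mem_faces_of_isFaceB Γ (by decide +kernel))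
  obtain ⟨R₄, hT₄, hp₄, hq₄⟩ := FaceCensus.exists_face_reads Γ e hmul hconj σ₀ (r := (765, 1028, 4112))
    (FaceCensus.mem_faces_of_isFaceB Γ (by decide +kernel))
  obtain ⟨R₅, hT₅, hp₅, hq₅⟩ := FaceCensus.exists_face_reads Γ e hmul hconj σ₀ (r := (765, 1028, 32896))
    (FaceCensus.mem_faces_of_isFaceB Γ (by decide +kernel))
  obtain ⟨R₆, hT₆, hp₆, hq₆⟩ := FaceCensus.exists_face_reads Γ e hmul hconj σ₀ (r := (765, 4112, 16448))
    (FaceCensus.mem_faces_of_isFaceB Γ (by decide +kernel))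
  obtain ⟨R₇, hT₇, hp₇, hq₇⟩ := FaceCensus.exists_face_reads Γ e hmul hconj σ₀ (r := (1275, 514, 2056))
    (FaceCensus.mem_faces_of_isFaceB Γ (by decide +kernel))
  obtain ⟨R₈, hT₈, hp₈, hq₈⟩ := FaceCensus.exists_face_reads Γ e hmul hconj σ₀ (r := (1275, 514, 4112))
    (FaceCensus.mem_faces_of_isFaceB Γ (by decide +kernel))
  obtain ⟨R₉, hT₉, hp₉, hq₉⟩ := FaceCensus.exists_face_reads Γ e hmul hconj σ₀ (r := (1275, 2056, 4112))
    (FaceCensus.mem_faces_of_isFaceB Γ (by decide +kernel))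
  obtain ⟨R₁₀, hT₁₀, hp₁₀, hq₁₀⟩ := FaceCensus.exists_face_reads Γ e hmul hconj σ₀ (r := (1275, 4112, 8224))
    (FaceCensus.mem_faces_of_isFaceB Γ (by decide +kernel))
  obtain ⟨R₁₁, hT₁₁, hp₁₁, hq₁₁⟩ := FaceCensus.exists_face_reads Γ e hmul hconj σ₀ (r := (1275, 8224, 16448))
    (FaceCensus.mem_faces_of_isFaceB Γ (by decide +kernel))
  obtain ⟨R₁₂, hT₁₂, hp₁₂, hq₁₂⟩ := FaceCensus.exists_face_reads Γ e hmul hconj σ₀ (r := (2295, 4112, 32896))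
    (FaceCensus.mem_faces_of_isFaceB Γ (by decide +kernel))
  obtain ⟨R₁₃, hT₁₃, hp₁₃, hq₁₃⟩ := FaceCensus.exists_face_reads Γ e hmul hconj σ₀ (r := (2805, 16448, 32896))
    (FaceCensus.mem_faces_of_isFaceB Γ (by decide +kernel))
  obtain ⟨R₁₄, hT₁₄, hp₁₄, hq₁₄⟩ := FaceCensus.exists_face_reads Γ e hmul hconj σ₀ (r := (4845, 2056, 8224))
    (FaceCensus.mem_faces_of_isFaceB Γ (by decide +kernel))
  obtain ⟨R₁₅, hT₁₅, hp₁₅, hq₁₅⟩ := FaceCensus.exists_face_reads Γ e hmul hconj σ₀ (r := (4845, 2056, 32896))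
    (FaceCensus.mem_faces_of_isFaceB Γ (by decide +kernel))
  exact ⟨R₁, R₂, R₃, R₄, R₅, R₆, R₇, R₈, R₉, R₁₀, R₁₁, R₁₂, R₁₃, R₁₄, R₁₅, ⟨fun P => by rw [← mem_pullType, ← e.symm_apply_apply P, ← hT₁.2 (e P), e.symm_apply_apply],
    hp₁, hq₁⟩, ⟨fun P => by rw [← mem_pullType, ← e.symm_apply_apply P, ← hT₂.2 (e P), e.symm_apply_apply],
    hp₂, hq₂⟩, ⟨fun P => by rw [← mem_pullType, ← e.symm_apply_apply P, ← hT₃.2 (e P), e.symm_apply_apply],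
    hp₃, hq₃⟩, ⟨fun P => by rw [← mem_pullType, ← e.symm_apply_apply P, ← hT₄.2 (e P), e.symm_apply_apply],
    hp₄, hq₄⟩, ⟨fun P => by rw [← mem_pullType, ← e.symm_apply_apply P, ← hT₅.2 (e P), e.symm_apply_apply],
    hp₅, hq₅⟩, ⟨fun P => by rw [← mem_pullType, ← e.symm_apply_apply P, ← hT₆.2 (e P), e.symm_apply_apply],
    hp₆, hq₆⟩, ⟨fun P => by rw [← mem_pullType, ← e.symm_apply_apply P, ← hT₇.2 (e P), e.symm_apply_apply],
    hp₇, hq₇⟩, ⟨fun P => by rw [← mem_pullType, ← e.symm_apply_apply P, ← hT₈.2 (e P), e.symm_apply_apply],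
    hp₈, hq₈⟩, ⟨fun P => by rw [← mem_pullType, ← e.symm_apply_apply P, ← hT₉.2 (e P), e.symm_apply_apply],
    hp₉, hq₉⟩, ⟨fun P => by rw [← mem_pullType, ← e.symm_apply_apply P, ← hT₁₀.2 (e P), e.symm_apply_apply],
    hp₁₀, hq₁₀⟩, ⟨fun P => by rw [← mem_pullType, ← e.symm_apply_apply P, ← hT₁₁.2 (e P), e.symm_apply_apply],
    hp₁₁, hq₁₁⟩, ⟨fun P => by rw [← mem_pullType, ← e.symm_apply_apply P, ← hT₁₂.2 (e P), e.symm_apply_apply],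
    hp₁₂, hq₁₂⟩, ⟨fun P => by rw [← mem_pullType, ← e.symm_apply_apply P, ← hT₁₃.2 (e P), e.symm_apply_apply],
    hp₁₃, hq₁₃⟩, ⟨fun P => by rw [← mem_pullType, ← e.symm_apply_apply P, ← hT₁₄.2 (e P), e.symm_apply_apply],
    hp₁₄, hq₁₄⟩, ⟨fun P => by rw [← mem_pullType, ← e.symm_apply_apply P, ← hT₁₅.2 (e P), e.symm_apply_apply],
    hp₁₅, hq₁₅⟩⟩

/-- **FIELD CLOSURE, type `ℤ/16` (cyclic, degree 16; `c = 8`) — period-witness form, CLOSED (headline).** `K`, `e`, `σ₀` as above and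
15 faces of `K` reading as the generating representatives; ONE period witness for each on the universe of record (some admissible
`ι₁`, some hermitian 3-space, some level, eigenforms at some `σ`) implies the Hodge conjecture, in every codimension, for every
complex abelian variety dominated by a finite product of abelian varieties realising CM types of CM fields embeddable in `K`.
(FRAMING: conditional on these 15 face periods; `HC_CM` is not proved.) [cite: Shimura1998, §6.2 Theorem 3 and §6.1 Corollary of
Theorem 2 (pp. 41–43)] [cite: Pohlmann1968, Thm. 1] [cite: Milne1999LefschetzClasses, Thm. 3.2 and Cor. 4.5] [cite: MumfordAV1970,
§19 Thm. 1 and p. 169] -/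
theorem hodgeConjectureFor_of_avDominatedBy_isProductOf_of_facePeriod_hexadecicCyclic (K : CMField) [IsGalois ℚ K]
    (e : GalT K ≃ Fin 16) (hmul : ∀ P Q : GalT K, e (P * Q) = Γ.mul (e P) (e Q)) (hconj : e conjT = Γ.conj)
    (σ₀ : (K : Type) →+* ℂ) (R₁ R₂ R₃ R₄ R₅ R₆ R₇ R₈ R₉ R₁₀ R₁₁ R₁₂ R₁₃ R₁₄ R₁₅ : Face K)
    (hR₁ : (∀ P : GalT K, P.1 σ₀ ∈ R₁.Φ.1 ↔ mem (e P) 255 = true) ∧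
      Γ.placeMask (e (translate σ₀ R₁.p)) = 257 ∧ Γ.placeMask (e (translate σ₀ R₁.p')) = 8224)
    (hR₂ : (∀ P : GalT K, P.1 σ₀ ∈ R₂.Φ.1 ↔ mem (e P) 255 = true) ∧
      Γ.placeMask (e (translate σ₀ R₂.p)) = 514 ∧ Γ.placeMask (e (translate σ₀ R₂.p')) = 16448)
    (hR₃ : (∀ P : GalT K, P.1 σ₀ ∈ R₃.Φ.1 ↔ mem (e P) 255 = true) ∧
      Γ.placeMask (e (translate σ₀ R₃.p)) = 4112 ∧ Γ.placeMask (e (translate σ₀ R₃.p')) = 8224)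
    (hR₄ : (∀ P : GalT K, P.1 σ₀ ∈ R₄.Φ.1 ↔ mem (e P) 765 = true) ∧
      Γ.placeMask (e (translate σ₀ R₄.p)) = 1028 ∧ Γ.placeMask (e (translate σ₀ R₄.p')) = 4112)
    (hR₅ : (∀ P : GalT K, P.1 σ₀ ∈ R₅.Φ.1 ↔ mem (e P) 765 = true) ∧
      Γ.placeMask (e (translate σ₀ R₅.p)) = 1028 ∧ Γ.placeMask (e (translate σ₀ R₅.p')) = 32896)
    (hR₆ : (∀ P : GalT K, P.1 σ₀ ∈ R₆.Φ.1 ↔ mem (e P) 765 = true) ∧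
      Γ.placeMask (e (translate σ₀ R₆.p)) = 4112 ∧ Γ.placeMask (e (translate σ₀ R₆.p')) = 16448)
    (hR₇ : (∀ P : GalT K, P.1 σ₀ ∈ R₇.Φ.1 ↔ mem (e P) 1275 = true) ∧
      Γ.placeMask (e (translate σ₀ R₇.p)) = 514 ∧ Γ.placeMask (e (translate σ₀ R₇.p')) = 2056)
    (hR₈ : (∀ P : GalT K, P.1 σ₀ ∈ R₈.Φ.1 ↔ mem (e P) 1275 = true) ∧
      Γ.placeMask (e (translate σ₀ R₈.p)) = 514 ∧ Γ.placeMask (e (translate σ₀ R₈.p')) = 4112)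
    (hR₉ : (∀ P : GalT K, P.1 σ₀ ∈ R₉.Φ.1 ↔ mem (e P) 1275 = true) ∧
      Γ.placeMask (e (translate σ₀ R₉.p)) = 2056 ∧ Γ.placeMask (e (translate σ₀ R₉.p')) = 4112)
    (hR₁₀ : (∀ P : GalT K, P.1 σ₀ ∈ R₁₀.Φ.1 ↔ mem (e P) 1275 = true) ∧
      Γ.placeMask (e (translate σ₀ R₁₀.p)) = 4112 ∧ Γ.placeMask (e (translate σ₀ R₁₀.p')) = 8224)
    (hR₁₁ : (∀ P : GalT K, P.1 σ₀ ∈ R₁₁.Φ.1 ↔ mem (e P) 1275 = true) ∧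
      Γ.placeMask (e (translate σ₀ R₁₁.p)) = 8224 ∧ Γ.placeMask (e (translate σ₀ R₁₁.p')) = 16448)
    (hR₁₂ : (∀ P : GalT K, P.1 σ₀ ∈ R₁₂.Φ.1 ↔ mem (e P) 2295 = true) ∧
      Γ.placeMask (e (translate σ₀ R₁₂.p)) = 4112 ∧ Γ.placeMask (e (translate σ₀ R₁₂.p')) = 32896)
    (hR₁₃ : (∀ P : GalT K, P.1 σ₀ ∈ R₁₃.Φ.1 ↔ mem (e P) 2805 = true) ∧
      Γ.placeMask (e (translate σ₀ R₁₃.p)) = 16448 ∧ Γ.placeMask (e (translate σ₀ R₁₃.p')) = 32896)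
    (hR₁₄ : (∀ P : GalT K, P.1 σ₀ ∈ R₁₄.Φ.1 ↔ mem (e P) 4845 = true) ∧
      Γ.placeMask (e (translate σ₀ R₁₄.p)) = 2056 ∧ Γ.placeMask (e (translate σ₀ R₁₄.p')) = 8224)
    (hR₁₅ : (∀ P : GalT K, P.1 σ₀ ∈ R₁₅.Φ.1 ↔ mem (e P) 4845 = true) ∧
      Γ.placeMask (e (translate σ₀ R₁₅.p)) = 2056 ∧ Γ.placeMask (e (translate σ₀ R₁₅.p')) = 32896)
    (h₁ : ∃ ι₁ : K →+* ℂ, R₁.Admissible ι₁ ∧ ∃ (V : HermSpace3 K ι₁) (σ : K →+* ℂ),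
      (Model.picardCMUniverse exists_isReal_hodgeModel_holds hodgePQ_independent_of_hodgeModel_holds
        BallQuotient.ballQuotientUniformised_holds cmAbelianVarietyRealised_holds).PeriodNV ι₁ V K R₁.psi σ)
    (h₂ : ∃ ι₁ : K →+* ℂ, R₂.Admissible ι₁ ∧ ∃ (V : HermSpace3 K ι₁) (σ : K →+* ℂ),
      (Model.picardCMUniverse exists_isReal_hodgeModel_holds hodgePQ_independent_of_hodgeModel_holds
        BallQuotient.ballQuotientUniformised_holds cmAbelianVarietyRealised_holds).PeriodNV ι₁ V K R₂.psi σ)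
    (h₃ : ∃ ι₁ : K →+* ℂ, R₃.Admissible ι₁ ∧ ∃ (V : HermSpace3 K ι₁) (σ : K →+* ℂ),
      (Model.picardCMUniverse exists_isReal_hodgeModel_holds hodgePQ_independent_of_hodgeModel_holds
        BallQuotient.ballQuotientUniformised_holds cmAbelianVarietyRealised_holds).PeriodNV ι₁ V K R₃.psi σ)
    (h₄ : ∃ ι₁ : K →+* ℂ, R₄.Admissible ι₁ ∧ ∃ (V : HermSpace3 K ι₁) (σ : K →+* ℂ),
      (Model.picardCMUniverse exists_isReal_hodgeModel_holds hodgePQ_independent_of_hodgeModel_holds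
        BallQuotient.ballQuotientUniformised_holds cmAbelianVarietyRealised_holds).PeriodNV ι₁ V K R₄.psi σ)
    (h₅ : ∃ ι₁ : K →+* ℂ, R₅.Admissible ι₁ ∧ ∃ (V : HermSpace3 K ι₁) (σ : K →+* ℂ),
      (Model.picardCMUniverse exists_isReal_hodgeModel_holds hodgePQ_independent_of_hodgeModel_holds
        BallQuotient.ballQuotientUniformised_holds cmAbelianVarietyRealised_holds).PeriodNV ι₁ V K R₅.psi σ)
    (h₆ : ∃ ι₁ : K →+* ℂ, R₆.Admissible ι₁ ∧ ∃ (V : HermSpace3 K ι₁) (σ : K →+* ℂ),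
      (Model.picardCMUniverse exists_isReal_hodgeModel_holds hodgePQ_independent_of_hodgeModel_holds
        BallQuotient.ballQuotientUniformised_holds cmAbelianVarietyRealised_holds).PeriodNV ι₁ V K R₆.psi σ)
    (h₇ : ∃ ι₁ : K →+* ℂ, R₇.Admissible ι₁ ∧ ∃ (V : HermSpace3 K ι₁) (σ : K →+* ℂ),
      (Model.picardCMUniverse exists_isReal_hodgeModel_holds hodgePQ_independent_of_hodgeModel_holds
        BallQuotient.ballQuotientUniformised_holds cmAbelianVarietyRealised_holds).PeriodNV ι₁ V K R₇.psi σ)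
    (h₈ : ∃ ι₁ : K →+* ℂ, R₈.Admissible ι₁ ∧ ∃ (V : HermSpace3 K ι₁) (σ : K →+* ℂ),
      (Model.picardCMUniverse exists_isReal_hodgeModel_holds hodgePQ_independent_of_hodgeModel_holds
        BallQuotient.ballQuotientUniformised_holds cmAbelianVarietyRealised_holds).PeriodNV ι₁ V K R₈.psi σ)
    (h₉ : ∃ ι₁ : K →+* ℂ, R₉.Admissible ι₁ ∧ ∃ (V : HermSpace3 K ι₁) (σ : K →+* ℂ),
      (Model.picardCMUniverse exists_isReal_hodgeModel_holds hodgePQ_independent_of_hodgeModel_holds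
        BallQuotient.ballQuotientUniformised_holds cmAbelianVarietyRealised_holds).PeriodNV ι₁ V K R₉.psi σ)
    (h₁₀ : ∃ ι₁ : K →+* ℂ, R₁₀.Admissible ι₁ ∧ ∃ (V : HermSpace3 K ι₁) (σ : K →+* ℂ),
      (Model.picardCMUniverse exists_isReal_hodgeModel_holds hodgePQ_independent_of_hodgeModel_holds
        BallQuotient.ballQuotientUniformised_holds cmAbelianVarietyRealised_holds).PeriodNV ι₁ V K R₁₀.psi σ)
    (h₁₁ : ∃ ι₁ : K →+* ℂ, R₁₁.Admissible ι₁ ∧ ∃ (V : HermSpace3 K ι₁) (σ : K →+* ℂ),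
      (Model.picardCMUniverse exists_isReal_hodgeModel_holds hodgePQ_independent_of_hodgeModel_holds
        BallQuotient.ballQuotientUniformised_holds cmAbelianVarietyRealised_holds).PeriodNV ι₁ V K R₁₁.psi σ)
    (h₁₂ : ∃ ι₁ : K →+* ℂ, R₁₂.Admissible ι₁ ∧ ∃ (V : HermSpace3 K ι₁) (σ : K →+* ℂ),
      (Model.picardCMUniverse exists_isReal_hodgeModel_holds hodgePQ_independent_of_hodgeModel_holds
        BallQuotient.ballQuotientUniformised_holds cmAbelianVarietyRealised_holds).PeriodNV ι₁ V K R₁₂.psi σ)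
    (h₁₃ : ∃ ι₁ : K →+* ℂ, R₁₃.Admissible ι₁ ∧ ∃ (V : HermSpace3 K ι₁) (σ : K →+* ℂ),
      (Model.picardCMUniverse exists_isReal_hodgeModel_holds hodgePQ_independent_of_hodgeModel_holds
        BallQuotient.ballQuotientUniformised_holds cmAbelianVarietyRealised_holds).PeriodNV ι₁ V K R₁₃.psi σ)
    (h₁₄ : ∃ ι₁ : K →+* ℂ, R₁₄.Admissible ι₁ ∧ ∃ (V : HermSpace3 K ι₁) (σ : K →+* ℂ),
      (Model.picardCMUniverse exists_isReal_hodgeModel_holds hodgePQ_independent_of_hodgeModel_holds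
        BallQuotient.ballQuotientUniformised_holds cmAbelianVarietyRealised_holds).PeriodNV ι₁ V K R₁₄.psi σ)
    (h₁₅ : ∃ ι₁ : K →+* ℂ, R₁₅.Admissible ι₁ ∧ ∃ (V : HermSpace3 K ι₁) (σ : K →+* ℂ),
      (Model.picardCMUniverse exists_isReal_hodgeModel_holds hodgePQ_independent_of_hodgeModel_holds
        BallQuotient.ballQuotientUniformised_holds cmAbelianVarietyRealised_holds).PeriodNV ι₁ V K R₁₅.psi σ)
    {P A : AbelianVariety ℂ} (hP : AbelianVariety.IsProductOf (fun B : AbelianVariety ℂ =>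
      ∃ (E : Type) (_ : Field E) (_ : NumberField E) (_ : IsCMField E) (_ : E →+* (K : Type)) (Φ : CMType E)
        (ι : 𝓞 E →+* End B) (θ : E →+* Module.End ℂ (complexBetti B.X 1)),
        IsCMTypeRealisation Φ B ι θ) P)
    (hA : AVDominatedBy A P) : HodgeConjectureFor A.dim A.X :=
  hodgeConjectureFor_of_avDominatedBy_isProductOf_of_exists_facePeriod_on K
    ((show 6 ≤ 16 by decide).trans_eq (FaceCensus.eq_finrank_of_enum e)) {R₁, R₂, R₃, R₄, R₅, R₆, R₇, R₈, R₉, R₁₀, R₁₁, R₁₂, R₁₃, R₁₄, R₁₅} σ₀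
    (hgen_hexadecicCyclic K e hmul hconj σ₀ {R₁, R₂, R₃, R₄, R₅, R₆, R₇, R₈, R₉, R₁₀, R₁₁, R₁₂, R₁₃, R₁₄, R₁₅} ⟨R₁, by simp, hR₁⟩ ⟨R₂, by simp, hR₂⟩ ⟨R₃, by simp, hR₃⟩ ⟨R₄, by simp, hR₄⟩ ⟨R₅, by simp, hR₅⟩ ⟨R₆, by simp, hR₆⟩ ⟨R₇, by simp, hR₇⟩ ⟨R₈, by simp, hR₈⟩ ⟨R₉, by simp, hR₉⟩ ⟨R₁₀, by simp, hR₁₀⟩ ⟨R₁₁, by simp, hR₁₁⟩ ⟨R₁₂, by simp, hR₁₂⟩ ⟨R₁₃, by simp, hR₁₃⟩ ⟨R₁₄, by simp, hR₁₄⟩ ⟨R₁₅, by simp, hR₁₅⟩)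
    (fun f hf => by
      simp only [Set.mem_insert_iff, Set.mem_singleton_iff] at hf
      rcases hf with rfl | rfl | rfl | rfl | rfl | rfl | rfl | rfl | rfl | rfl | rfl | rfl | rfl | rfl | rfl
      · exact h₁
      · exact h₂
      · exact h₃
      · exact h₄
      · exact h₅
      · exact h₆
      · exact h₇
      · exact h₈
      · exact h₉
      · exact h₁₀
      · exact h₁₁
      · exact h₁₂
      · exact h₁₃
      · exact h₁₄
      · exact h₁₅) hP hA


end Summit.HodgeConjecture.CorCM.HexadecicFaceTransport.Cyclic

end
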